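import Literature.Computability.AlgebraicComplexity.ABV17SingPermFourPivot
import HarnessLib

/-!
# Alper–Bogart–Velasco 2017, §1: `codim Sing(perm_4) ≥ 7` — the height statement

Last file of the series (framing: `ABV17SingPermFourPrelim.lean`).  From the standard-pivot theorem
`seven_le_height_of_pivot` (`ABV17SingPermFourPivot.lean`):

* `eight_le_of_two_rows_zero`, `eight_le_of_subperm_two_eq_zero` — permanental rank `≤ 1`: if all
  `2 × 2` subpermanents of a `4 × 4` point over a domain vanish (`2 ≠ 0`), two rows vanish or every
  row has at most one nonzero entry — at least eight zero coordinates, height `≥ 8`;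
* `exists_perm_fin_four` — a permutation of `Fin 4` with prescribed values at `0, 1`;
* `seven_le_height_ker_aeval_of_fourByFour` — **`7 ≤ ht (ker (f ↦ f(a)))` for every `4 × 4` point
  `a` over a domain `L ⊇ K` (`2 ≠ 0` in `K`) with vanishing `3 × 3` subpermanents** (move a
  nonvanishing `2 × 2` subpermanent to the standard pivot by permuting rows and columns;
  kernel heights are invariant, `height_ker_aeval_comp_equiv`);
* `seven_le_height_of_subpermIdeal_four_le` — every prime of `F[X_{4×4}]` over the `3 × 3`
  subpermanents has height `≥ 7` (`2 ≠ 0` in `F`);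
* `seven_le_height_singPermIdeal_four` — **`7 ≤ ht (per₄, ∂per₄/∂x_ij) ≤ 8`**: the clause
  "`codim(Sing(perm_4)) = 8`" of Alper–Bogart–Velasco 2017, §1 (arXiv:1505.02205 p0003 L38, a
  Macaulay2 computation) in the tree's height currency, PROVED up to one unit: lower bound `7` here,
  upper bound `8` = the tree's `alperBogartVelasco2017_rem_1_5`; the last unit `8 ≤` is NOT typed.
  In `ABV17SingularLocusBound`'s dictionary `singIdeal (perPoly (Fin 4) F) = singPermIdeal F 4`
  (`singIdeal_perPoly`, `rfl`), so this reads `7 ≤ codim Sing(per₄)`.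

Consumer: the (4,2) strength rung of Summits line `laplace_rigidity` on crux `CoverDecancellation`
(`Summit.….Theorems.PolyaContinuedLaplaceRigidity.Strength.strengthTwoPerFourGeFour_of_seven_le_height`:
`per₄` is not a sum of three products of two quadrics, whereas `det₄` is).  Honest framing:
dictionary work on von zur Gathen's problem; VP ≠ VNP is NOT proved and no rung of any route is
moved by this file alone.

## References
* J. Alper, T. Bogart, M. Velasco, *A lower bound for the determinantal complexity of a
  hypersurface*, Found. Comput. Math. 17 (2017) 829–836, arXiv:1505.02205, §1 (p0003 L38), Rem. 1.5.
  [AlperBogartVelasco2017]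
* A. Boralevi, E. Carlini, M. Michałek, E. Ventura, Adv. Math. 461 (2025), arXiv:2402.17839,
  Thm. 4.14 ("`5 ≤ codim Sing ≤ 2k`"; `k = 4`: `7 ≤ · ≤ 8` here). [BoraleviCarliniMichalekVentura2025]
-/

noncomputable section

open Matrix MvPolynomial Finset

namespace Literature.Computability.AlgebraicComplexity

open VonZurGathen BoraleviCarliniMichalekVentura2025

namespace AlperBogartVelasco

variable {K : Type*} [Field K] {L : Type*} [CommRing L] [IsDomain L] [Algebra K L]

/-! ### Permanental rank `≤ 1`: eight zero coordinates -/

/-- Two zero rows of a `4 × 4` point: eight vanishing coordinates, height `≥ 8`.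
[cite: AlperBogartVelasco2017, Rem. 1.5] -/
theorem eight_le_of_two_rows_zero (a : Fin 4 × Fin 4 → L) {s t : Fin 4} (hst : s ≠ t)
    (hs : ∀ j, a (s, j) = 0) (ht : ∀ j, a (t, j) = 0) :
    (8 : ℕ∞) ≤ (RingHom.ker (aeval (R := K) a)).height := by
  refine le_trans ?_ (card_le_height_ker_aeval (K := K) a
    ((({s, t} : Finset (Fin 4)) ×ˢ (Finset.univ : Finset (Fin 4)))) ?_)
  · rw [Finset.card_product, Finset.card_pair hst, Finset.card_univ, Fintype.card_fin]
    norm_num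
  · rintro ⟨r, c⟩ hx
    have hr : r ∈ ({s, t} : Finset (Fin 4)) := (Finset.mem_product.1 hx).1
    simp only [Finset.mem_insert, Finset.mem_singleton] at hr
    rcases hr with rfl | rfl
    · exact hs c
    · exact ht c

/-- **Permanental rank `≤ 1`** (all `2 × 2` subpermanents vanish, `2 ≠ 0`): height `≥ 8`.  Either
every row has at most one nonzero entry (twelve zero coordinates), or a row `r` has
`a_{rc} a_{rd} ≠ 0`; then a row `s ≠ r` with `a_{sc} = 0` vanishes (`a_{rc} a_{sj} = −a_{rj} a_{sc}`),
and two rows `s, t ≠ r` with `a_{sc} a_{tc} ≠ 0` are impossible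
(`a_{rc}(a_{sc}a_{td} + a_{sd}a_{tc}) = −2 a_{rd}a_{sc}a_{tc}`), so two of the three other rows
vanish — the case analysis of the tree's `height_ker_aeval_ge_of_threeByThree`.
[cite: AlperBogartVelasco2017, §1 (sentence introducing Cor. 1.4), arXiv text p0003 L38] -/
theorem eight_le_of_subperm_two_eq_zero (h2 : (2 : K) ≠ 0) (a : Fin 4 × Fin 4 → L)
    (hvan : ∀ r s i j : Fin 4, r ≠ s → i ≠ j → a (r, i) * a (s, j) + a (r, j) * a (s, i) = 0) :
    (8 : ℕ∞) ≤ (RingHom.ker (aeval (R := K) a)).height := by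
  classical
  have h2L : (2 : L) ≠ 0 := fun h =>
    h2 ((algebraMap K L).injective (by rw [map_ofNat, map_zero]; exact h))
  by_cases h1 : ∀ r : Fin 4, ∃ c : Fin 4, ∀ j, j ≠ c → a (r, j) = 0
  · -- every row has at most one nonzero entry: twelve vanishing coordinates
    choose c hc using h1
    set G : Finset (Fin 4 × Fin 4) := Finset.univ.image fun r => (r, c r) with hG
    have hGcard : G.card = 4 := by
      rw [hG, Finset.card_image_of_injective _ (fun r r' h => congrArg Prod.fst h),
        Finset.card_univ, Fintype.card_fin]
    refine le_trans ?_ (card_le_height_ker_aeval (K := K) a Gᶜ ?_)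
    · rw [Finset.card_compl, hGcard, Fintype.card_prod, Fintype.card_fin]
      norm_num
    · rintro ⟨r, j⟩ hx
      refine hc r j fun hj => ?_
      rw [Finset.mem_compl] at hx
      exact hx (Finset.mem_image.2 ⟨r, Finset.mem_univ _, by rw [hj]⟩)
  · push Not at h1
    obtain ⟨r, hr⟩ := h1
    obtain ⟨c, -, hc⟩ := hr 0
    obtain ⟨d, hdc, hd⟩ := hr c
    have rowA : ∀ s, s ≠ r → a (s, c) = 0 → ∀ j, a (s, j) = 0 := by
      intro s hsr hsc j
      by_cases hjc : j = c
      · rw [hjc]; exact hsc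
      · have h := hvan r s c j (Ne.symm hsr) (Ne.symm hjc)
        rw [hsc, mul_zero, add_zero] at h
        exact (mul_eq_zero.1 h).resolve_left hc
    have twoLive : ∀ s t, s ≠ r → t ≠ r → s ≠ t → a (s, c) ≠ 0 → a (t, c) ≠ 0 → False := by
      intro s t hsr htr hst hsc htc
      have hs := hvan r s c d (Ne.symm hsr) (Ne.symm hdc)
      have ht := hvan r t c d (Ne.symm htr) (Ne.symm hdc)
      have hst' := hvan s t c d hst (Ne.symm hdc)
      have key : a (r, c) * (a (s, c) * a (t, d) + a (s, d) * a (t, c)) =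
          -(2 * (a (r, d) * a (s, c)) * a (t, c)) := by
        have e1 : a (r, c) * a (s, d) = -(a (r, d) * a (s, c)) := eq_neg_of_add_eq_zero_left hs
        have e2 : a (r, c) * a (t, d) = -(a (r, d) * a (t, c)) := eq_neg_of_add_eq_zero_left ht
        linear_combination a (s, c) * e2 + a (t, c) * e1
      rw [hst', mul_zero] at key
      have h0 : 2 * (a (r, d) * a (s, c)) * a (t, c) = 0 := neg_eq_zero.1 key.symm
      rcases mul_eq_zero.1 h0 with h | h
      · rcases mul_eq_zero.1 h with h' | h'
        · exact h2L h'
        · exact (mul_ne_zero hd hsc) h'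
      · exact htc h
    -- two of the three rows other than `r` vanish
    have hothers : 1 < ((Finset.univ : Finset (Fin 4)).erase r).card := by
      rw [Finset.card_erase_of_mem (Finset.mem_univ r), Finset.card_univ, Fintype.card_fin]
      norm_num
    by_cases hlive : ∃ s, s ≠ r ∧ a (s, c) ≠ 0
    · obtain ⟨s, hsr, hsc⟩ := hlive
      have h2' : 1 < (((Finset.univ : Finset (Fin 4)).erase r).erase s).card := by
        rw [Finset.card_erase_of_mem (by simp [hsr]), Finset.card_erase_of_mem (Finset.mem_univ r),
          Finset.card_univ, Fintype.card_fin]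
        norm_num
      obtain ⟨t, ht, t', ht', htt'⟩ := Finset.one_lt_card.1 h2'
      simp only [Finset.mem_erase, Finset.mem_univ, and_true] at ht ht'
      have htc : a (t, c) = 0 := by
        by_contra h; exact twoLive s t hsr ht.2 (Ne.symm ht.1) hsc h
      have ht'c : a (t', c) = 0 := by
        by_contra h; exact twoLive s t' hsr ht'.2 (Ne.symm ht'.1) hsc h
      exact eight_le_of_two_rows_zero (K := K) a htt' (rowA t ht.2 htc) (rowA t' ht'.2 ht'c)
    · push Not at hlive
      obtain ⟨t, ht, t', ht', htt'⟩ := Finset.one_lt_card.1 hothers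
      simp only [Finset.mem_erase, Finset.mem_univ, and_true] at ht ht'
      exact eight_le_of_two_rows_zero (K := K) a htt' (rowA t ht (hlive t ht))
        (rowA t' ht' (hlive t' ht'))

/-! ### Moving a pivot to the standard position -/

/-- A permutation of `Fin 4` with prescribed distinct values at `0` and `1`.
[cite: AlperBogartVelasco2017, §1 (sentence introducing Cor. 1.4), arXiv text p0003 L38] -/
theorem exists_perm_fin_four (r₁ r₂ : Fin 4) (h : r₁ ≠ r₂) :
    ∃ σ : Equiv.Perm (Fin 4), σ 0 = r₁ ∧ σ 1 = r₂ := by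
  revert r₁ r₂
  decide

/-- **`codim Sing(perm_4) ≥ 7` at every point**: if all `3 × 3` subpermanents of a `4 × 4`
matrix `a` over a domain `L ⊇ K` (`2 ≠ 0` in `K`) vanish, the prime `{f : f(a) = 0} ⊆ K[X_{4×4}]`
has height `≥ 7`.  If all `2 × 2` subpermanents vanish: `eight_le_of_subperm_two_eq_zero`;
otherwise permute rows and columns to put a nonvanishing `2 × 2` subpermanent at `{0,1} × {0,1}`
(`height_ker_aeval_comp_equiv`) and apply `seven_le_height_of_pivot`.
[cite: AlperBogartVelasco2017, §1 (sentence introducing Cor. 1.4), arXiv text p0003 L38] -/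
theorem seven_le_height_ker_aeval_of_fourByFour (h2 : (2 : K) ≠ 0) (a : Fin 4 × Fin 4 → L)
    (hvan : ∀ r₀ r₁ r₂ c₀ c₁ c₂ : Fin 4, r₀ ≠ r₁ → r₀ ≠ r₂ → r₁ ≠ r₂ → c₀ ≠ c₁ → c₀ ≠ c₂ → c₁ ≠ c₂ →
      a (r₀, c₀) * (a (r₁, c₁) * a (r₂, c₂) + a (r₁, c₂) * a (r₂, c₁)) +
        a (r₀, c₁) * (a (r₁, c₀) * a (r₂, c₂) + a (r₁, c₂) * a (r₂, c₀)) +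
        a (r₀, c₂) * (a (r₁, c₀) * a (r₂, c₁) + a (r₁, c₁) * a (r₂, c₀)) = 0) :
    (7 : ℕ∞) ≤ (RingHom.ker (aeval (R := K) a)).height := by
  by_cases hall : ∀ r s i j : Fin 4, r ≠ s → i ≠ j → a (r, i) * a (s, j) + a (r, j) * a (s, i) = 0
  · exact le_trans (by norm_num) (eight_le_of_subperm_two_eq_zero (K := K) h2 a hall)
  push Not at hall
  obtain ⟨r₁, r₂, c₁, c₂, hr, hc, hg⟩ := hall
  obtain ⟨σ, hσ0, hσ1⟩ := exists_perm_fin_four r₁ r₂ hr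
  obtain ⟨τ, hτ0, hτ1⟩ := exists_perm_fin_four c₁ c₂ hc
  set a' : Fin 4 × Fin 4 → L := fun p => a (σ p.1, τ p.2) with ha'
  have hvan' : ∀ r₀ r₁ r₂ c₀ c₁ c₂ : Fin 4, r₀ ≠ r₁ → r₀ ≠ r₂ → r₁ ≠ r₂ → c₀ ≠ c₁ → c₀ ≠ c₂ →
      c₁ ≠ c₂ →
      a' (r₀, c₀) * (a' (r₁, c₁) * a' (r₂, c₂) + a' (r₁, c₂) * a' (r₂, c₁)) +
        a' (r₀, c₁) * (a' (r₁, c₀) * a' (r₂, c₂) + a' (r₁, c₂) * a' (r₂, c₀)) +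
        a' (r₀, c₂) * (a' (r₁, c₀) * a' (r₂, c₁) + a' (r₁, c₁) * a' (r₂, c₀)) = 0 := by
    intro r₀ r₁' r₂' c₀ c₁' c₂' h₀₁ h₀₂ h₁₂ k₀₁ k₀₂ k₁₂
    simp only [ha']
    exact hvan _ _ _ _ _ _ (σ.injective.ne h₀₁) (σ.injective.ne h₀₂) (σ.injective.ne h₁₂)
      (τ.injective.ne k₀₁) (τ.injective.ne k₀₂) (τ.injective.ne k₁₂)
  have hg' : a' (0, 0) * a' (1, 1) + a' (0, 1) * a' (1, 0) ≠ 0 := by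
    simp only [ha', hσ0, hσ1, hτ0, hτ1]
    exact hg
  have h7 := seven_le_height_of_pivot (K := K) h2 a' hvan' hg'
  have hcomp : a' = a ∘ (Equiv.prodCongr σ τ) := by
    funext ⟨x, y⟩
    rfl
  rwa [hcomp, height_ker_aeval_comp_equiv (K := K) (Equiv.prodCongr σ τ) a] at h7

/-! ### The height statements -/

/-- **Every prime over the `3 × 3` permanents of the generic `4 × 4` matrix has height `≥ 7`**
(`2 ≠ 0` in `F`, every field): the generic point of `F[X]/P` is a `4 × 4` matrix over a domain with
vanishing `3 × 3` subpermanents. [cite: AlperBogartVelasco2017, §1 (sentence introducing Cor. 1.4), arXiv text p0003 L38] -/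
theorem seven_le_height_of_subpermIdeal_four_le (F : Type*) [Field F] (h2 : (2 : F) ≠ 0)
    (P : Ideal (MvPolynomial (Fin 4 × Fin 4) F)) [P.IsPrime] (hP : subpermIdeal F 4 4 3 ≤ P) :
    (7 : ℕ∞) ≤ P.height := by
  classical
  let a : Fin 4 × Fin 4 → MvPolynomial (Fin 4 × Fin 4) F ⧸ P := fun x => Ideal.Quotient.mk P (X x)
  have hker := ker_aeval_quotientMk (K := F) P
  have hvan : ∀ r₀ r₁ r₂ c₀ c₁ c₂ : Fin 4, r₀ ≠ r₁ → r₀ ≠ r₂ → r₁ ≠ r₂ → c₀ ≠ c₁ → c₀ ≠ c₂ →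
      c₁ ≠ c₂ →
      a (r₀, c₀) * (a (r₁, c₁) * a (r₂, c₂) + a (r₁, c₂) * a (r₂, c₁)) +
        a (r₀, c₁) * (a (r₁, c₀) * a (r₂, c₂) + a (r₁, c₂) * a (r₂, c₀)) +
        a (r₀, c₂) * (a (r₁, c₀) * a (r₂, c₁) + a (r₁, c₁) * a (r₂, c₀)) = 0 := by
    intro r₀ r₁ r₂ c₀ c₁ c₂ h₀₁ h₀₂ h₁₂ k₀₁ k₀₂ k₁₂
    have hRc : ({r₀, r₁, r₂} : Finset (Fin 4)).card = 3 := by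
      rw [Finset.card_insert_of_notMem (by simp [h₀₁, h₀₂]), Finset.card_pair h₁₂]
    have hCc : ({c₀, c₁, c₂} : Finset (Fin 4)).card = 3 := by
      rw [Finset.card_insert_of_notMem (by simp [k₀₁, k₀₂]), Finset.card_pair k₁₂]
    have hmem : rsubperm (mvPolynomialX (Fin 4) (Fin 4) F) (· ∈ ({c₀, c₁, c₂} : Finset (Fin 4)))
        (· ∈ ({r₀, r₁, r₂} : Finset (Fin 4))) ∈ P :=
      hP (rsubperm_mem_subpermIdeal hRc hCc)
    rw [← hker, RingHom.mem_ker, aeval_rsubperm_X, rsubperm_triple _ h₀₁ h₀₂ h₁₂ k₀₁ k₀₂ k₁₂]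
      at hmem
    simpa only [Matrix.of_apply] using hmem
  rw [← hker]
  exact seven_le_height_ker_aeval_of_fourByFour h2 a hvan

/-- **Alper–Bogart–Velasco 2017, §1, the clause `codim(Sing(perm_4)) = 8`, typed up to one unit:
`7 ≤ ht (per₄, ∂per₄/∂x_ij)`** over every field with `2 ≠ 0` (`VonZurGathen.singPermIdeal F 4 =
singIdeal (perPoly (Fin 4) F)` by `singIdeal_perPoly`, `rfl`; `= subpermIdeal F 4 4 3` by
`singPermIdeal_eq_subpermIdeal`).  PROVED by generic-point case analysis; the printed value is `8`
(Macaulay2); `≤ 8` is `alperBogartVelasco2017_rem_1_5`.  This is the first value of von zur Gathen's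
problem beyond `k = 3` in the tree and separates `per₄` from `det₄` (`codim Sing(det₄) = 4`).
[cite: AlperBogartVelasco2017, §1 (sentence introducing Cor. 1.4), arXiv text p0003 L38] -/
theorem seven_le_height_singPermIdeal_four (F : Type*) [Field F] (h2 : (2 : F) ≠ 0) :
    (7 : ℕ∞) ≤ (VonZurGathen.singPermIdeal F 4).height := by
  rw [singPermIdeal_eq_subpermIdeal F (m := 4) (by norm_num), Ideal.height_eq_inf_minimalPrimes]
  refine le_iInf₂ fun P hP => ?_
  haveI := hP.1.1
  exact seven_le_height_of_subpermIdeal_four_le F h2 P hP.1.2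

/-- The sandwich `7 ≤ codim Sing(per₄) ≤ 8` in the height currency of `ABV17SingularLocusBound`
(`codim Sing(f) = (singIdeal f).height`), over every field with `2 ≠ 0`; the printed value is `8`.
[cite: AlperBogartVelasco2017, §1 (sentence introducing Cor. 1.4) and Rem. 1.5] -/
theorem height_singIdeal_perPoly_four_bounds (F : Type*) [Field F] (h2 : (2 : F) ≠ 0) :
    (7 : ℕ∞) ≤ (singIdeal (perPoly (Fin 4) F)).height ∧
      (singIdeal (perPoly (Fin 4) F)).height ≤ 8 := by
  refine ⟨?_, ?_⟩
  · rw [singIdeal_perPoly]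
    exact seven_le_height_singPermIdeal_four F h2
  · have h := alperBogartVelasco2017_rem_1_5 F (n := 4) (by norm_num)
    exact_mod_cast h

end AlperBogartVelasco

end Literature.Computability.AlgebraicComplexity

end
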